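import Summits.CriticalPhenomena.CardyFormulaZ2.Theses.CardyRotToConf
import Literature.Probability.RandomPlanarGeometry.PlanarDomainsTopology
import Literature.Topology.PlaneTopology.Janiszewski
import Literature.Topology.PlaneTopology.OpenSetArcs
import Literature.Topology.PlaneTopology.JordanCurveProofs
import HarnessLib

/-!
# Slit topology for the one-shot surgery (cdisprove brick T1, crux `CardyRotToConfR2SymmetryUpgrade`)

Negative-lane helper file (no Theses statement is asserted).  Elementary plane topology used by
the Markov kernel of the surgery family `J† = chord ⋆ S(crosscut domain)`:

* `interior_segment_eq_empty`, `mem_closure_diff_of_interior_eq_empty` — segments are thin;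
* `isConnected_diff_segment` — removing from a Jordan domain a straight slit that touches the
  boundary only at its base point does not disconnect it (Janiszewski's theorem with
  `A = ∂D`, `B =` the slit, `A ∩ B = {a}`);
* `remainingDomain_eq_diff_segment` — hence the remaining domain after a partial chord is the
  slit domain `D ∖ [a, p]`;
* `carrier_eq_of_diff_eq` — a Jordan domain is recovered from any of its slit domains
  (`D ∖ L = D' ∖ L'` with thin `L, L'` forces `D = D'`), by the common-boundary property of the
  Jordan curve (`JordanDomain.frontier_subset_closure_exterior`);
* `not_exists_carrier_eq_diff_segment` — a slit domain is not the carrier of a Jordan domain.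
-/

namespace Summit.CriticalPhenomena.CardyFormulaZ2.Theorems.CardyRotToConfR2SymmetryUpgrade.Negative

open Set Metric Filter Topology
open Literature.Probability.RandomPlanarGeometry Literature.Topology.PlaneTopology

/-! ### Segments are thin -/

/-- A perpendicular displacement leaves the segment. [folklore] -/
theorem add_perp_notMem_segment {a p : ℂ} (hap : a ≠ p) {z : ℂ} (hz : z ∈ segment ℝ a p)
    {s : ℝ} (hs : s ≠ 0) : z + (s : ℂ) * (Complex.I * (p - a)) ∉ segment ℝ a p := by
  rw [segment_eq_image'] at hz ⊢
  obtain ⟨θ₀, -, rfl⟩ := hz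
  rintro ⟨θ, -, hθ⟩
  simp only [Complex.real_smul] at hθ
  have hv : p - a ≠ 0 := sub_ne_zero.2 hap.symm
  have key : ((θ : ℂ) - θ₀ - s * Complex.I) * (p - a) = 0 := by linear_combination hθ
  have h2 : (θ : ℂ) - θ₀ - s * Complex.I = 0 := (mul_eq_zero.1 key).resolve_right hv
  have := congrArg Complex.im h2
  simp at this
  exact hs this

/-- A non-degenerate segment has empty interior in the plane. [folklore] -/
theorem interior_segment_eq_empty {a p : ℂ} (hap : a ≠ p) : interior (segment ℝ a p) = ∅ := by
  rw [eq_empty_iff_forall_notMem]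
  intro z hz
  rcases Metric.mem_nhds_iff.1 (mem_interior_iff_mem_nhds.1 hz) with ⟨ε, hε, hball⟩
  have hv : 0 < ‖p - a‖ := norm_pos_iff.2 (sub_ne_zero.2 hap.symm)
  set s : ℝ := ε / (2 * ‖p - a‖) with hs_def
  have hs : 0 < s := by positivity
  have hmem : z + (s : ℂ) * (Complex.I * (p - a)) ∈ ball z ε := by
    have hsn : s * ‖p - a‖ = ε / 2 := by
      rw [hs_def, div_mul_eq_mul_div, div_eq_iff (by positivity)]
      ring
    rw [mem_ball, dist_eq_norm, add_sub_cancel_left, norm_mul, norm_mul, Complex.norm_I, one_mul,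
      Complex.norm_real, Real.norm_eq_abs, abs_of_pos hs, hsn]
    linarith
  exact add_perp_notMem_segment hap (interior_subset hz) hs.ne' (hball hmem)

/-- A point of an open set is a limit of points of the open set off a thin set. [folklore] -/
theorem mem_closure_diff_of_interior_eq_empty {U L : Set ℂ} (hU : IsOpen U) (hL : interior L = ∅)
    {z : ℂ} (hz : z ∈ U) : z ∈ closure (U \ L) := by
  rw [_root_.mem_closure_iff]
  intro V hV hzV
  by_contra hne
  rw [not_nonempty_iff_eq_empty] at hne
  have hsub : V ∩ U ⊆ L := by
    intro w hw
    by_contra hwL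
    have : w ∈ V ∩ (U \ L) := ⟨hw.1, hw.2, hwL⟩
    rw [hne] at this
    exact this
  have : z ∈ interior L := interior_mono hsub (by rw [(hV.inter hU).interior_eq]; exact ⟨hzV, hz⟩)
  rw [hL] at this
  exact this

/-- An open set minus a thin set is dense in the open set. [folklore] -/
theorem closure_diff_of_interior_eq_empty {U L : Set ℂ} (hU : IsOpen U) (hL : interior L = ∅) :
    closure (U \ L) = closure U :=
  (closure_mono fun _ h => h.1).antisymm
    (closure_minimal (fun _ hz => mem_closure_diff_of_interior_eq_empty hU hL hz) isClosed_closure)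

/-! ### Removing a slit from a Jordan domain -/

/-- **A boundary slit does not disconnect a Jordan domain.** If the segment `[a, p]` meets `∂D`
only at `a` and otherwise lies in `D`, then `D ∖ [a, p]` is preconnected (Janiszewski).
[folklore] -/
theorem isPreconnected_diff_segment (D : JordanDomain) {a p : ℂ} (ha : a ∈ frontier D.carrier)
    (hap : a ≠ p) (hL : segment ℝ a p \ {a} ⊆ D.carrier) :
    IsPreconnected (D.carrier \ segment ℝ a p) := by
  set A : Set ℂ := frontier D.carrier with hA
  set B : Set ℂ := segment ℝ a p with hB
  have hAc : IsCompact A :=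
    (Metric.isCompact_iff_isClosed_bounded).2 ⟨isClosed_frontier,
      D.isBounded.closure.subset frontier_subset_closure⟩
  have hBc : IsCompact B := (IsSimpleArc.segment hap).isCompact
  have hAB : A ∩ B = {a} := by
    refine Subset.antisymm ?_ (singleton_subset_iff.2 ⟨ha, left_mem_segment ℝ a p⟩)
    rintro z ⟨hzA, hzB⟩
    by_contra hza
    have hzD : z ∈ D.carrier := hL ⟨hzB, hza⟩
    exact Set.disjoint_left.1 D.disjoint_carrier_frontier hzD hzA
  have hABc : IsPreconnected (A ∩ B) := by rw [hAB]; exact isPreconnected_singleton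
  have hDA : D.carrier ⊆ Aᶜ := fun z hz hzA => Set.disjoint_left.1 D.disjoint_carrier_frontier hz hzA
  refine isPreconnected_of_forall_pair fun x hx y hy => ?_
  have hyA : y ∈ connectedComponentIn Aᶜ x :=
    D.isConnected.isPreconnected.subset_connectedComponentIn hx.1 hDA hy.1
  have hyB : y ∈ connectedComponentIn Bᶜ x :=
    (IsSimpleArc.segment hap).isConnected_compl.isPreconnected.subset_connectedComponentIn hx.2
      Subset.rfl hy.2
  have hyAB := janiszewski hAc hBc hABc hyA hyB
  set C := connectedComponentIn (A ∪ B)ᶜ x with hC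
  have hCsub : C ⊆ (A ∪ B)ᶜ := connectedComponentIn_subset _ _
  have hxC : x ∈ C := mem_connectedComponentIn (fun h => h.elim (hDA hx.1) hx.2)
  have hCD : C ⊆ D.carrier := by
    refine isPreconnected_connectedComponentIn.subset_of_closure_inter_subset D.isOpen ⟨x, hxC, hx.1⟩ ?_
    rintro z ⟨hzc, hzC⟩
    rw [closure_eq_self_union_frontier] at hzc
    exact hzc.resolve_right fun h => hCsub hzC (Or.inl h)
  exact ⟨C, fun z hz => ⟨hCD hz, fun h => hCsub hz (Or.inr h)⟩, hxC, hyAB,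
    isPreconnected_connectedComponentIn⟩

/-- **A boundary slit does not disconnect a Jordan domain** (connected form). [folklore] -/
theorem isConnected_diff_segment (D : JordanDomain) {a p : ℂ} (ha : a ∈ frontier D.carrier)
    (hap : a ≠ p) (hL : segment ℝ a p \ {a} ⊆ D.carrier) :
    IsConnected (D.carrier \ segment ℝ a p) := by
  refine ⟨?_, isPreconnected_diff_segment D ha hap hL⟩
  obtain ⟨z, hz⟩ := D.nonempty
  have hzc := mem_closure_diff_of_interior_eq_empty D.isOpen (interior_segment_eq_empty hap) hz
  by_contra hne
  rw [not_nonempty_iff_eq_empty] at hne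
  rw [hne, closure_empty] at hzc
  exact hzc

/-- The component of any point of the slit domain is the whole slit domain. [folklore] -/
theorem connectedComponentIn_diff_segment (D : JordanDomain) {a p : ℂ} (ha : a ∈ frontier D.carrier)
    (hap : a ≠ p) (hL : segment ℝ a p \ {a} ⊆ D.carrier) {z : ℂ}
    (hz : z ∈ D.carrier \ segment ℝ a p) :
    connectedComponentIn (D.carrier \ segment ℝ a p) z = D.carrier \ segment ℝ a p :=
  (connectedComponentIn_subset _ _).antisymm
    ((isPreconnected_diff_segment D ha hap hL).subset_connectedComponentIn hz Subset.rfl)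

/-- **The remaining domain after a partial chord is the slit domain**: if the explored piece has
trace the segment `[a, p]` from `a = D.pt 0`, touching `∂D` at `a` only, then
`remainingDomain D past = D ∖ [a, p]`. [folklore] -/
theorem remainingDomain_eq_diff_segment (D : DobrushinDomain) (past : CurveClass ℂ) {p : ℂ}
    (hrange : past.range = segment ℝ (D.pt 0) p) (hap : D.pt 0 ≠ p)
    (hL : segment ℝ (D.pt 0) p \ {D.pt 0} ⊆ D.carrier) :
    remainingDomain D past = D.carrier \ segment ℝ (D.pt 0) p := by
  ext z
  simp only [remainingDomain, mem_setOf_eq, hrange]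
  constructor
  · exact fun h => h.1
  · intro hz
    refine ⟨hz, ?_⟩
    rw [connectedComponentIn_diff_segment D.toJordanDomain (D.pt_mem_frontier 0) hap hL hz,
      closure_diff_of_interior_eq_empty D.isOpen (interior_segment_eq_empty hap)]
    exact frontier_subset_closure (D.pt_mem_frontier 1)

/-! ### A Jordan domain is determined by its slit domains -/

/-- One inclusion of `carrier_eq_of_diff_eq`. [folklore] -/
theorem carrier_subset_of_diff_eq {D D' : JordanDomain} {L L' : Set ℂ} (hL : interior L = ∅)
    (h : D.carrier \ L = D'.carrier \ L') : D.carrier ⊆ D'.carrier := by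
  intro z hz
  by_contra hzD'
  rcases Metric.isOpen_iff.1 D.isOpen z hz with ⟨ε, hε, hball⟩
  -- the ball around `z` lies in the closure of `D'`
  have hcl : ball z ε ⊆ closure D'.carrier := by
    intro w hw
    have hwc : w ∈ closure (ball z ε \ L) :=
      mem_closure_diff_of_interior_eq_empty isOpen_ball hL hw
    refine closure_mono ?_ hwc
    intro u hu
    have : u ∈ D.carrier \ L := ⟨hball hu.1, hu.2⟩
    rw [h] at this
    exact this.1
  -- so `z` is a frontier point of `D'`, hence a limit of exterior points: contradiction
  have hzf : z ∈ frontier D'.carrier := by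
    rw [D'.isOpen.frontier_eq]
    exact ⟨hcl (mem_ball_self hε), hzD'⟩
  have hze := D'.frontier_subset_closure_exterior JordanCurveTheorem_holds hzf
  rcases Metric.mem_closure_iff.1 hze ε hε with ⟨w, hw, hzw⟩
  exact hw (hcl (mem_ball'.2 hzw))

/-- **Slit domains determine the domain**: if `D ∖ L = D' ∖ L'` for thin sets `L, L'` then the
two Jordan domains coincide. [folklore] -/
theorem carrier_eq_of_diff_eq {D D' : JordanDomain} {L L' : Set ℂ} (hL : interior L = ∅)
    (hL' : interior L' = ∅) (h : D.carrier \ L = D'.carrier \ L') : D.carrier = D'.carrier :=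
  (carrier_subset_of_diff_eq hL h).antisymm (carrier_subset_of_diff_eq hL' h.symm)

/-- **A genuine slit domain is not a Jordan domain**: if the thin set `L` meets `D` then `D ∖ L` is
not the carrier of any Jordan domain. [folklore] -/
theorem not_exists_carrier_eq_diff {D : JordanDomain} {L : Set ℂ} (hL : interior L = ∅)
    (hLD : (L ∩ D.carrier).Nonempty) : ¬ ∃ D' : JordanDomain, D'.carrier = D.carrier \ L := by
  rintro ⟨D', hD'⟩
  have h : D'.carrier \ ∅ = D.carrier \ L := by rw [hD']; simp
  have heq := carrier_eq_of_diff_eq (D := D') (D' := D) interior_empty hL h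
  obtain ⟨z, hzL, hzD⟩ := hLD
  have : z ∈ D'.carrier := heq ▸ hzD
  rw [hD'] at this
  exact this.2 hzL

/-- The slit of a partial chord meets the domain, so `D ∖ [a, p]` is not a Jordan carrier.
[folklore] -/
theorem not_exists_carrier_eq_diff_segment (D : JordanDomain) {a p : ℂ} (hap : a ≠ p)
    (hL : segment ℝ a p \ {a} ⊆ D.carrier) :
    ¬ ∃ D' : JordanDomain, D'.carrier = D.carrier \ segment ℝ a p :=
  not_exists_carrier_eq_diff (interior_segment_eq_empty hap)
    ⟨p, right_mem_segment ℝ a p, hL ⟨right_mem_segment ℝ a p, fun h => hap (mem_singleton_iff.1 h).symm⟩⟩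

end Summit.CriticalPhenomena.CardyFormulaZ2.Theorems.CardyRotToConfR2SymmetryUpgrade.Negative
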